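import Mathlib
import Summits.Ventures.HodgeRepro.Tier4.Target
import Summits.Ventures.HodgeRepro.Tier4.Line3.Defs
import Summits.Ventures.HodgeRepro.Tier4.Line3.LocaliserS
import Summits.Ventures.HodgeRepro.Tier4.Line3.MajorantLemmas
import Summits.Ventures.HodgeRepro.Tier4.Line3.ClassBoundGauss
import Summits.Ventures.HodgeRepro.Tier4.Line3.ClassBound
import Summits.Ventures.HodgeRepro.Tier4.Line3.ClassBoundDef
import Summits.Ventures.HodgeRepro.Tier4.Line3.DecaySum
import Summits.Ventures.HodgeRepro.Tier4.Line3.TermMajorantMass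
import Summits.Ventures.HodgeRepro.Tier4.Line3.OrbitPartition

/-!
# Tier4/Line3/SupportMass — THE ASSEMBLY OF L3.5, REPAIRED: the residual on the SUPPORT with the DEFINITE Gaussians

Blind re-derivation cell `pub-hodge-repro`, Tier 4 «PROVE THE STEP» (README §9–§10), LINE L3, seat t4-L2-p3 on L3.5
`term_dominated` (lead S12234).  Supersedes `OrbitPartition.MajorantMassBound` / `term_dominated_of_majorantMassBound`
(S12794: that residual summed `majorantAt` over ALL line tuples — a dense set in the ball coordinates — and is
unsatisfiable whenever the domain is non-empty, so that assembly is vacuous).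

THE RESIDUAL (vi) of L3.5, `SupportMassBound`: for the support-restricted majorant with the definite Gaussians
`suppMajorant D ℓ c₁ e N w z = 1_{coefQ D.cf (loc N) (rep w) ≠ 0}(w) · majorantAt D.Φ e w z · ∏_k gaussDefAt c₁ (rep w k)`
(`ClassBoundDef.majorantDefAt`), the depth-`N` domain integral of the majorant sum grows at most like `M₀ q₁^N`:
`∫⁻_{D_N} Σ'_w ofReal (suppMajorant … N w z) ≤ ofReal (M₀ q₁^N)`, plus pointwise summability on the domain.  The support
at depth `N` lies in the lines of `xm + (𝔭𝔭̄)^N L`, `L ∈ S` (`LocS.supp`) — a SUBSET of the fixed cosets `xm + L` — and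
`suppMajorant` is a Gaussian of a positive-definite form on `(E ⊗ ℝ)³` (the half Gaussian `e^{−(π/2) maj}` at `τ₀`,
`gaussDefAt c₁` at the definite places) times a polynomial: the lattice sum converges, uniformly on `{nsq ≤ r}`.  The
growth in `N` is the index of the level (`CongruenceIndex`, `≤ (q₀^d)^{9N}`) times the boundary distance of the chosen
domain; it is NOT choice-independent (the majorant is not a `Γ′`-invariant density), so (vi) is a statement about the
tree's `domain` — the BHC cocompactness row + the DomainTransfer tiling — NOT proved here.

THE ASSEMBLY (`term_dominated_of_supportMassBound`): with (vi) and the class bound `summand_bound_off_main_def`,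
`term_dominated` holds, by the orbit partition of `OrbitPartition` (`ENNReal.tsum_fiberwise` + `lintegral_tsum`) with
`summand = 0` off the support.

Nothing here asserts anything about the truth of (P); HC_CM is NOT proved by anyone in this repository.
-/

set_option autoImplicit false

noncomputable section

namespace Summit.Ventures.HodgeRepro.Tier4.Line3

open MeasureTheory Matrix NumberField
open scoped ENNReal

namespace T4Data

variable (X : T4Data)

/-- The support of the localiser at depth `N`: the line tuples with a non-zero quadruple coefficient. -/
def suppSet (D : X.ThetaData) {p : IsDedekindDomain.HeightOneSpectrum (RingOfIntegers X.E)}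
    {L₀ : Submodule (RingOfIntegers X.E) (Fin 3 → X.E)} {xm : X.Tuple} (ℓ : X.LocS D p L₀ xm) (N : ℕ) :
    Set X.LineTuple :=
  {w | X.coefQ D.cf (ℓ.loc N) (X.rep w) ≠ 0}

/-- The support-restricted majorant with the definite Gaussians: `majorantDefAt c₁` on the support, `0` off it. -/
def suppMajorant (D : X.ThetaData) {p : IsDedekindDomain.HeightOneSpectrum (RingOfIntegers X.E)}
    {L₀ : Submodule (RingOfIntegers X.E) (Fin 3 → X.E)} {xm : X.Tuple} (ℓ : X.LocS D p L₀ xm) (c₁ e : ℝ) (N : ℕ)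
    (w : X.LineTuple) (z : Fin 2 → ℂ) : ℝ :=
  Set.indicator (X.suppSet D ℓ N) (fun w => X.majorantDefAt c₁ D.Φ e w z) w

/-- `0 ≤ suppMajorant`. -/
theorem suppMajorant_nonneg (D : X.ThetaData) {p : IsDedekindDomain.HeightOneSpectrum (RingOfIntegers X.E)}
    {L₀ : Submodule (RingOfIntegers X.E) (Fin 3 → X.E)} {xm : X.Tuple} (ℓ : X.LocS D p L₀ xm) (c₁ e : ℝ) (N : ℕ)
    (w : X.LineTuple) (z : Fin 2 → ℂ) : 0 ≤ X.suppMajorant D ℓ c₁ e N w z :=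
  Set.indicator_nonneg (fun w _ => X.majorantDefAt_nonneg c₁ D.Φ e w z) w

/-- The majorant with the definite Gaussians is continuous on the ball. -/
theorem continuousOn_majorantDefAt (c₁ : ℝ) (Φ : KMDatumS) (e : ℝ) (w : X.LineTuple) :
    ContinuousOn (fun z => X.majorantDefAt c₁ Φ e w z) ball :=
  (X.continuousOn_majorantAt Φ e w).mul continuousOn_const

/-- `ofReal ∘ suppMajorant` is a.e.-measurable on a measurable subset of the ball. -/
theorem aemeasurable_ofReal_suppMajorant (D : X.ThetaData)
    {p : IsDedekindDomain.HeightOneSpectrum (RingOfIntegers X.E)}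
    {L₀ : Submodule (RingOfIntegers X.E) (Fin 3 → X.E)} {xm : X.Tuple} (ℓ : X.LocS D p L₀ xm) (c₁ e : ℝ) (N : ℕ)
    (w : X.LineTuple) {K : Set (Fin 2 → ℂ)} (hK : MeasurableSet K) (hKb : K ⊆ ball) :
    AEMeasurable (fun z => ENNReal.ofReal (X.suppMajorant D ℓ c₁ e N w z)) (volume.restrict K) := by
  unfold suppMajorant
  by_cases hw : w ∈ X.suppSet D ℓ N
  · simp only [Set.indicator_of_mem hw]
    exact ENNReal.measurable_ofReal.comp_aemeasurable
      (((X.continuousOn_majorantDefAt c₁ D.Φ e w).mono hKb).aemeasurable hK)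
  · simp only [Set.indicator_of_notMem hw, ENNReal.ofReal_zero]
    exact aemeasurable_const

/-! ### The residual (vi), repaired, and the assembly -/

/-- **THE RESIDUAL OF L3.5** as one displayed input: the depth-`N` domain integral of the support-restricted majorant
with the definite Gaussians grows at most like `M₀ q₁^N`. -/
structure SupportMassBound (D : X.ThetaData) (p : IsDedekindDomain.HeightOneSpectrum (RingOfIntegers X.E))
    (L₀ : Submodule (RingOfIntegers X.E) (Fin 3 → X.E)) (xm : X.Tuple) (ℓ : X.LocS D p L₀ xm) (c₁ e : ℝ) where
  /-- the growth constant -/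
  M₀ : ℝ
  M₀_nonneg : 0 ≤ M₀
  /-- the growth base (the index of the level times the boundary distance of the domain) -/
  q₁ : ℝ
  q₁_nonneg : 0 ≤ q₁
  /-- the majorant sum over the support converges at every point of the domain -/
  summable : ∀ N (z : Fin 2 → ℂ), z ∈ X.domain (ℓ.level N) → Summable (fun w => X.suppMajorant D ℓ c₁ e N w z)
  /-- the majorant mass of the depth-`N` domain -/
  bound : ∀ N, ∫⁻ z in X.domain (ℓ.level N), ∑' w, ENNReal.ofReal (X.suppMajorant D ℓ c₁ e N w z) ≤
    ENNReal.ofReal (M₀ * q₁ ^ N)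

/-- The orbit's support-majorant mass at depth `N`. -/
def orbitMassS (D : X.ThetaData) (p : IsDedekindDomain.HeightOneSpectrum (RingOfIntegers X.E))
    (L₀ : Submodule (RingOfIntegers X.E) (Fin 3 → X.E)) (xm : X.Tuple) (ℓ : X.LocS D p L₀ xm) (c₁ e : ℝ)
    (N : ℕ) (o : X.Orbit) : ℝ≥0∞ :=
  ∫⁻ z in X.domain (ℓ.level N), ∑' w : X.orbitOf ⁻¹' {o}, ENNReal.ofReal (X.suppMajorant D ℓ c₁ e N w.1 z)

/-- **THE ORBIT PARTITION**: the orbit masses add up to the total support-majorant mass. -/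
theorem tsum_orbitMassS (D : X.ThetaData) (p : IsDedekindDomain.HeightOneSpectrum (RingOfIntegers X.E))
    (L₀ : Submodule (RingOfIntegers X.E) (Fin 3 → X.E)) (xm : X.Tuple) (ℓ : X.LocS D p L₀ xm) (c₁ e : ℝ)
    (N : ℕ) :
    ∑' o, X.orbitMassS D p L₀ xm ℓ c₁ e N o =
      ∫⁻ z in X.domain (ℓ.level N), ∑' w, ENNReal.ofReal (X.suppMajorant D ℓ c₁ e N w z) := by
  unfold orbitMassS
  rw [← lintegral_tsum]
  · refine lintegral_congr fun z => ?_
    exact ENNReal.tsum_fiberwise (fun w => ENNReal.ofReal (X.suppMajorant D ℓ c₁ e N w z)) X.orbitOf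
  · intro o
    exact AEMeasurable.tsum fun w =>
      X.aemeasurable_ofReal_suppMajorant D ℓ c₁ e N w.1 (X.measurableSet_domain _) (X.domain_subset_ball _)

/-- **L3.5 FROM THE CLASS BOUND AND THE RESIDUAL.** -/
theorem term_dominated_of_supportMassBound (D : X.ThetaData)
    (p : IsDedekindDomain.HeightOneSpectrum (RingOfIntegers X.E))
    (L₀ : Submodule (RingOfIntegers X.E) (Fin 3 → X.E)) (xm : X.Tuple)
    (h02 : xm 2 = xm 0) (h13 : xm 3 = xm 1) (hab : LinearIndependent X.E ![xm 0, xm 1]) (ℓ : X.LocS D p L₀ xm)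
    (hq : 1 < (Ideal.absNorm p.asIdeal : ℝ))
    (hres : ∀ c₁ e : ℝ, 0 < c₁ → X.SupportMassBound D p L₀ xm ℓ c₁ e) :
    ∃ bound : X.Orbit → ℝ, (∀ o, 0 ≤ bound o) ∧ Summable bound ∧
      ∀ N (o : X.Orbit), o ≠ X.orbitOf (X.lines xm) →
        ‖X.term D.Φ D.cf (ℓ.level N) (ℓ.loc N) o‖ ≤ bound o := by
  obtain ⟨B, e, κ, C₁, c₁, hκ, hB, hC₁, hc₁, hclass⟩ := X.summand_bound_off_main_def D p L₀ xm h02 h13 hab ℓ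
  obtain ⟨M₀, hM₀, q₁, hq₁, hsumm, hmass⟩ := hres c₁ e hc₁
  have hdpos : 0 < Module.finrank ℚ X.E := Module.finrank_pos
  -- notation: the decay factor, its `ℝ≥0∞` version, the orbit masses
  obtain ⟨eN, heN⟩ : ∃ eN : ℕ → ℝ, ∀ N, eN N =
      Real.exp (-(κ * (((Ideal.absNorm p.asIdeal : ℝ) ^ N) ^ ((Module.finrank ℚ X.E : ℝ)⁻¹)))) := ⟨_, fun _ => rfl⟩
  have heN0 : ∀ N, 0 ≤ eN N := fun N => by rw [heN]; exact (Real.exp_pos _).le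
  obtain ⟨c, hc⟩ : ∃ c : ℕ → ℝ≥0∞, ∀ N, c N = ENNReal.ofReal (B * C₁ * eN N) := ⟨_, fun _ => rfl⟩
  have hc_ne : ∀ N, c N ≠ ⊤ := fun N => by rw [hc]; exact ENNReal.ofReal_ne_top
  obtain ⟨m, hm⟩ : ∃ m : ℕ → X.Orbit → ℝ≥0∞, ∀ N o, m N o = X.orbitMassS D p L₀ xm ℓ c₁ e N o :=
    ⟨_, fun _ _ => rfl⟩
  -- (1) the depth-`N` masses add up to at most `ofReal (M₀ q₁^N)`
  have hmass' : ∀ N, ∑' o, m N o ≤ ENNReal.ofReal (M₀ * q₁ ^ N) := fun N => by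
    simp only [hm]
    rw [X.tsum_orbitMassS]
    exact hmass N
  -- (2) the real series `S N = B C₁ M₀ q₁^N e_N` is summable and nonnegative
  obtain ⟨S, hS⟩ : ∃ S : ℕ → ℝ, ∀ N, S N = B * C₁ * M₀ * (q₁ ^ N * eN N) := ⟨_, fun _ => rfl⟩
  have hS0 : ∀ N, 0 ≤ S N := fun N => by
    rw [hS]
    exact mul_nonneg (mul_nonneg (mul_nonneg hB hC₁) hM₀) (mul_nonneg (pow_nonneg hq₁ N) (heN0 N))
  have hSsum : Summable S := by
    have h := (summable_pow_mul_exp_neg_root (q₁ := q₁) (q := (Ideal.absNorm p.asIdeal : ℝ)) (κ := κ) hq₁ hq hκ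
      (d := Module.finrank ℚ X.E) hdpos).mul_left (B * C₁ * M₀)
    refine h.congr fun N => ?_
    rw [hS, heN]
  -- (3) `c N * Σ_o m N o ≤ ofReal (S N)`
  have hcm : ∀ N, c N * ∑' o, m N o ≤ ENNReal.ofReal (S N) := fun N => by
    calc c N * ∑' o, m N o ≤ c N * ENNReal.ofReal (M₀ * q₁ ^ N) :=
          mul_le_mul_right (hmass' N) _
      _ = ENNReal.ofReal (S N) := by
          rw [hc, hS, ← ENNReal.ofReal_mul (mul_nonneg (mul_nonneg hB hC₁) (heN0 N))]
          congr 1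
          ring
  -- (4) the double sum is finite
  have htotal : ∑' o, ∑' N, c N * m N o ≠ ⊤ := by
    rw [ENNReal.tsum_comm]
    refine ne_top_of_le_ne_top (b := ∑' N, ENNReal.ofReal (S N)) ?_ ?_
    · rw [← ENNReal.ofReal_tsum_of_nonneg hS0 hSsum]
      exact ENNReal.ofReal_ne_top
    · refine ENNReal.tsum_le_tsum fun N => ?_
      rw [ENNReal.tsum_mul_left]
      exact hcm N
  have hrow : ∀ o, ∑' N, c N * m N o ≠ ⊤ := fun o =>
    ne_top_of_le_ne_top htotal (ENNReal.le_tsum o)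
  -- (5) the bound and its properties
  refine ⟨fun o => (∑' N, c N * m N o).toReal, fun o => ENNReal.toReal_nonneg,
    ENNReal.summable_toReal htotal, fun N o ho => ?_⟩
  -- the orbital term against the orbit's mass, through the class bound
  have hterm : ‖X.term D.Φ D.cf (ℓ.level N) (ℓ.loc N) o‖ ≤ (c N * m N o).toReal := by
    unfold term
    refine (norm_integral_le_lintegral_norm _).trans ?_
    refine ENNReal.toReal_mono (ne_top_of_le_ne_top (hrow o) (ENNReal.le_tsum N)) ?_
    rw [hm, orbitMassS, ← lintegral_const_mul' _ _ (hc_ne N)]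
    refine lintegral_mono_ae ((ae_restrict_iff' (X.measurableSet_domain _)).mpr (Filter.Eventually.of_forall
      fun z hz => ?_))
    have hzb : z ∈ ball := X.domain_subset_ball _ hz
    -- the fibre of `o` as the subtype `{w // orbitOf w = o}`
    have hsub : Summable (fun w : {w : X.LineTuple // X.orbitOf w = o} => X.suppMajorant D ℓ c₁ e N w.1 z) :=
      (hsumm N z hz).subtype _
    have hbound : ∀ w : {w : X.LineTuple // X.orbitOf w = o},
        ‖X.summand D.Φ D.cf (ℓ.loc N) w.1 z‖ ≤ (B * C₁ * eN N) * X.suppMajorant D ℓ c₁ e N w.1 z := by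
      intro w
      unfold suppMajorant
      by_cases hw : w.1 ∈ X.suppSet D ℓ N
      · rw [Set.indicator_of_mem hw]
        have h := hclass N w.1 z hzb (by rw [w.2]; exact ho)
        rw [heN]
        calc ‖X.summand D.Φ D.cf (ℓ.loc N) w.1 z‖ ≤ B * X.majorantDefAt c₁ D.Φ e w.1 z *
              (C₁ * Real.exp (-(κ * (((Ideal.absNorm p.asIdeal : ℝ) ^ N) ^ ((Module.finrank ℚ X.E : ℝ)⁻¹))))) := h
          _ = (B * C₁ * Real.exp (-(κ * (((Ideal.absNorm p.asIdeal : ℝ) ^ N) ^ ((Module.finrank ℚ X.E : ℝ)⁻¹))))) *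
              X.majorantDefAt c₁ D.Φ e w.1 z := by ring
      · -- off the support the summand vanishes
        rw [Set.indicator_of_notMem hw, mul_zero]
        have hcoef : X.coefQ D.cf (ℓ.loc N) (X.rep w.1) = 0 := by
          by_contra h
          exact hw h
        unfold summand
        rw [hcoef, zero_mul, norm_zero]
    have hsumm_norm : Summable (fun w : {w : X.LineTuple // X.orbitOf w = o} =>
        ‖X.summand D.Φ D.cf (ℓ.loc N) w.1 z‖) :=
      Summable.of_nonneg_of_le (fun w => norm_nonneg _) hbound (hsub.mul_left _)
    have hreal : ‖∑' w : {w : X.LineTuple // X.orbitOf w = o}, X.summand D.Φ D.cf (ℓ.loc N) w.1 z‖ ≤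
        (B * C₁ * eN N) * ∑' w : {w : X.LineTuple // X.orbitOf w = o}, X.suppMajorant D ℓ c₁ e N w.1 z := by
      calc ‖∑' w : {w : X.LineTuple // X.orbitOf w = o}, X.summand D.Φ D.cf (ℓ.loc N) w.1 z‖
          ≤ ∑' w : {w : X.LineTuple // X.orbitOf w = o}, ‖X.summand D.Φ D.cf (ℓ.loc N) w.1 z‖ :=
            norm_tsum_le_tsum_norm hsumm_norm
        _ ≤ ∑' w : {w : X.LineTuple // X.orbitOf w = o}, (B * C₁ * eN N) * X.suppMajorant D ℓ c₁ e N w.1 z :=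
            Summable.tsum_le_tsum hbound hsumm_norm (hsub.mul_left _)
        _ = (B * C₁ * eN N) * ∑' w : {w : X.LineTuple // X.orbitOf w = o}, X.suppMajorant D ℓ c₁ e N w.1 z :=
            tsum_mul_left
    -- pass to `ℝ≥0∞` and to the fibre subtype of `orbitMassS`
    have hfib : ∑' w : {w : X.LineTuple // X.orbitOf w = o}, ENNReal.ofReal (X.suppMajorant D ℓ c₁ e N w.1 z) =
        ∑' w : X.orbitOf ⁻¹' {o}, ENNReal.ofReal (X.suppMajorant D ℓ c₁ e N w.1 z) :=
      (Equiv.subtypeEquivRight fun w => Iff.rfl).tsum_eq (fun w : X.orbitOf ⁻¹' {o} =>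
        ENNReal.ofReal (X.suppMajorant D ℓ c₁ e N w.1 z))
    calc ENNReal.ofReal ‖∑' w : {w : X.LineTuple // X.orbitOf w = o}, X.summand D.Φ D.cf (ℓ.loc N) w.1 z‖
        ≤ ENNReal.ofReal ((B * C₁ * eN N) *
            ∑' w : {w : X.LineTuple // X.orbitOf w = o}, X.suppMajorant D ℓ c₁ e N w.1 z) :=
          ENNReal.ofReal_le_ofReal hreal
      _ = c N * ∑' w : {w : X.LineTuple // X.orbitOf w = o}, ENNReal.ofReal (X.suppMajorant D ℓ c₁ e N w.1 z) := by
          rw [hc, ENNReal.ofReal_mul (mul_nonneg (mul_nonneg hB hC₁) (heN0 N)),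
            ENNReal.ofReal_tsum_of_nonneg (fun w => X.suppMajorant_nonneg _ _ _ _ _ _ _) hsub]
      _ = c N * ∑' w : X.orbitOf ⁻¹' {o}, ENNReal.ofReal (X.suppMajorant D ℓ c₁ e N w.1 z) := by rw [hfib]
  refine hterm.trans ?_
  exact ENNReal.toReal_mono (hrow o) (ENNReal.le_tsum N)

end T4Data

end Summit.Ventures.HodgeRepro.Tier4.Line3

end
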